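import Literature.MathematicalPhysics.QuantumFieldTheory.Balaban1983to89.B4TwoScaleForm

/-!
# `Balaban1983to89.B6Eq24Partition` — T. Bałaban, *Propagators and renormalization transformations for lattice gauge
theories. II*, Commun. Math. Phys. **96** (1984) 223–250 [Balaban1984PropagatorsII]: the multiscale geometry
**(2.1)–(2.4)** p. 224 and the gauge functions `N(Q′)` (2.7)/(2.10) on the cell's concrete lattice carrier, with the
partition **(2.4) `T = ⋃_{j=0}^k B^j(Λ_j)` PROVED** — the substrate of the multiscale Poincaré inequality (2.11)
(sibling `…Balaban1983to89.B6Eq211`, same seat)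

statement-level skeleton of published theorems with citation tags; proofs where landed; nothing here is a claim about the Yang–Mills mass gap

PDF held: `paper:balaban1984-cmp96-propagators-rt-ii` (journal page = PDF page + 222); displays read from the page render
`run/shared/lean/pub/pub-balaban/b2b-balaban-ref1/pages/1984-cmp96-propagators-rt-II/…-p002-x2.png` (p. 224) and
`…-p003-x2.png` (p. 225), and `[4]` = [Balaban1984PropagatorsI] pp. 18–20 (`…1984-cmp95-propagators-rt-I-p002…p004-x2.png`),
AS IMAGES.

CITATION HEADER / WHAT IS REPRODUCED.  Cell `lit-balaban`, Phase 2 seat **p03** (unit `lit-balaban-p03`, HOME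
`run/shared/lean/pub/lit-balaban/`), support file for SKELETON row **B6.Eq2.11**; it also gives SKELETON rows **B6.Eq2.3**
((2.3)–(2.4); of record: the abstract `B6LevelGapMetric.ZonesOf`) and **B6.Eq2.7** ((2.7)/(2.10); of record: the
abstract kernel `B6SectA.gaugeSpace`) a CONCRETE instance.  Printed, p. 224 [PDF 2], verbatim: *"We consider a
sequence of domains Ω₁ ⊃ Ω₂ ⊃ … ⊃ Ω_k, Ω_j ⊂ T_η, j = 1, 2, …, k, (2.1) which satisfy the following conditions:
Ω_j = B^j(Ω_j^{(j)}), Ω_j^{(j)} ⊂ T^{(j)}_{L^jη} and it is a sum of big blocks, (L^jη)^{−1}dist(Ω_j^c, Ω_{j+1}) > RM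
(2.2) … Let us define Λ_j = Ω_j^{(j)}∖Ω_{j+1}^{(j)}, j = 1, …, k − 1, Λ_k = Ω_k^{(k)}, Λ₀ = Ω₁^c (2.3) for the sets of
sites and the sets of bonds; thus we have Ω₁ = ⋃_{j=1}^k B^j(Λ_j), T = ⋃_{j=0}^k B^j(Λ_j), where B⁰(Λ₀) = Λ₀. (2.4)
Let us notice that we admit the case when some domains Ω_j are equal to T_η"*; (2.7) *"λ = 0 on Λ₀, Q′_jλ = 0 on Λ_j,
j = 1, …, k"*; p. 225 [PDF 3]: *"N(Q′) = {λ : λ satisfies (2.7)} (2.10)"* and, after (2.14), *"we assume that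
(Q′₀λ)(x) = λ(x), x ∈ Λ₀"*.  The blocks and averages are those of [4]: *"B(y) = {x ∈ T₁ : y_μ ≤ x_μ < y_μ + L,
μ = 1, …, d}, y ∈ T^{(1)}_L (1.6)"* (p. 18), *"(Q′λ)(y) = Σ_{x∈B(y)}L^{−d}λ(x)"* ((1.13) p. 19), *"(Q′_kλ)(y) =
Σ_{x∈B^k(y)} η^dλ(x)"* ((1.20) p. 20, `η = L^{−k}`).

CARRIER / DICTIONARY (the cell's concrete torus carrier of `B4TorusPositivity` / `B4Block227` §6 / `B4TwoScaleForm`,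
lattice units `η = 1`): sites of `T_η` ↦ a finite `T ⊂ ℤ^D` (`D` = the dimension `d`; for the torus `Π_μ ℤ/P_μ` take
`T = B4TorusPositivity.box P`); a point `y` of `T^{(j)}_{L^jη}` ↦ its LABEL `y ∈ ℤ^D` (the site is `L^j·y`), so that
`B^j(y) = L^j·y + [0,L^j)^D = B4TwoScaleForm.ablock (L^j) y` ((1.6), corner-anchored) and the `(j+1)`-block containing
the level-`j` point `y` has label `⌊y/L⌋ = B4Green244.coarse L y`; `Ω_j^{(j)}` ↦ `Domains.Ω j` (label sets, `1 ≤ j ≤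
k`), nesting (2.1) and `Ω_j ⊂ T_η` as the two structure axioms (the separation clause of (2.2), irrelevant here, is the
business of `B6LevelGapMetric` / `B6BoxChartsNested`); (2.3) with the printed conventions `Ω₀^{(0)} := T_η`,
`Ω_{k+1} := ∅` is ONE formula `Λ_j = Ω_j^{(j)} ∖ Ω_{j+1}^{(j)}` (`Domains.lam`); `(Q′_jλ)(y)` ↦ `qAvg L j y λ =
L^{−jD}Σ_{x∈B^j(y)}λ(x)` (so `Q′₀λ = λ`); `N(Q′)` ↦ `Domains.NQ`.  `λ` is complex-valued (print: real).

WHAT IS PROVED (kernel-checked, 0 sorry, no `Prop`-valued fact; `B4TwoScaleForm` + Mathlib only): membership lemmas;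
`nq_iff` (`N(Q′)` = the two printed clauses); **`B^j(Λ_j) = Ω_j ∖ Ω_{j+1}`** on sites (`blk_eq_sdiff`); **(2.1) on
sites** `Ω_{j+1} ⊆ Ω_j` for every `j` (`oms_succ_subset`, `oms_antitone`); **(2.4)**: the `B^j(Λ_j)` are pairwise
disjoint (`blk_disjoint`) and their union over `0 ≤ j ≤ k` is `T_η` (`biUnion_blk`); the block family `{B^j(y) :
y ∈ Λ_j, 0 ≤ j ≤ k}` (`cells`) is pairwise disjoint and inside `T_η` — the input of (2.11).  NOT HERE: (2.11) itself
(sibling `B6Eq211`), the separation clause of (2.2), bonds (the *"sets of bonds"* reading of (2.3)).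
-/

namespace Literature.MathematicalPhysics.QuantumFieldTheory.Balaban1983to89.B6Eq24Partition

open Literature.MathematicalPhysics.QuantumFieldTheory.Balaban1983to89.B4Green244 (coarse)
open Literature.MathematicalPhysics.QuantumFieldTheory.Balaban1983to89.B4TwoScaleForm

noncomputable section

variable {D : ℕ}

/-! ## §1 The geometry (2.1)–(2.4) and the gauge functions (2.7)/(2.10) of Sect. A, in label coordinates -/

/-- **The domains (2.1)–(2.2)** p. 224 [PDF 2], in label coordinates and lattice units (module docstring, DICTIONARY):
`L` = the block size (print: a large odd integer; only `1 ≤ L` is used), `k` = the number of levels, `T` = the sites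
of `T_η`, `Ω j` = the labels of *"Ω_j^{(j)} ⊂ T^{(j)}_{L^jη}"* for `j = 1, …, k` (values of `Ω` outside `1 … k` are
never read), so that *"Ω_j = B^j(Ω_j^{(j)})"* `= ⋃_{y ∈ Ω j} (L^j·y + [0,L^j)^D)`; the axioms are (2.1): `nested` =
*"Ω₁ ⊃ Ω₂ ⊃ … ⊃ Ω_k"* (the `(j+1)`-block of label `⌊y/L⌋` containing the level-`j` point `y` is listed only if `y` is:
`Ω_{j+1}^{(j)} ⊆ Ω_j^{(j)}`) and `sub_T` = *"Ω_j ⊂ T_η"*.  The clause of (2.2) *"it is a sum of big blocks,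
(L^jη)^{−1}dist(Ω_j^c, Ω_{j+1}) > RM"* plays no role in (2.11) and is not a field. [cite: Balaban1984PropagatorsII, (2.1)–(2.2) p.224] -/
structure Domains (D : ℕ) where
  L : ℕ
  k : ℕ
  T : Finset (Fin D → ℤ)
  Ω : ℕ → Finset (Fin D → ℤ)
  one_le_L : 1 ≤ L
  nested : ∀ j, 1 ≤ j → j < k → ∀ y : Fin D → ℤ, coarse L y ∈ Ω (j + 1) → y ∈ Ω j
  sub_T : ∀ j, 1 ≤ j → j ≤ k → ∀ y ∈ Ω j, ablock (L ^ j) y ⊆ T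

/-- **The scalar block average `Q′_j`** of [4] in lattice units: `(Q′_jλ)(y) = L^{−jD}·Σ_{x ∈ B^j(y)} λ(x)`, the
average of `λ` over the level-`j` block of label `y` ([4] (1.13) p. 19: `(Q′λ)(y) = Σ_{x∈B(y)}L^{−d}λ(x)`; (1.20) p. 20:
`(Q′_kλ)(y) = Σ_{x∈B^k(y)} η^dλ(x)`, `η = L^{−k}`); for `j = 0` it is `λ(y)` itself, the p. 225 convention *"(Q′₀λ)(x)
= λ(x), x ∈ Λ₀"*. [cite: Balaban1984PropagatorsI, (1.13) p.19, (1.20) p.20] -/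
def qAvg (L j : ℕ) (y : Fin D → ℤ) (lam : (Fin D → ℤ) → ℂ) : ℂ :=
  ((((L : ℂ) ^ j) ^ D)⁻¹) * ∑ x ∈ ablock (L ^ j) y, lam x

/-- `(Q′_jλ)(y) = 0` iff the block sum `Σ_{x∈B^j(y)}λ(x)` vanishes (`L ≥ 1`). [cite: Balaban1984PropagatorsI, (1.20) p.20] -/
theorem qAvg_eq_zero_iff {L : ℕ} (hL : 1 ≤ L) (j : ℕ) (y : Fin D → ℤ) (lam : (Fin D → ℤ) → ℂ) :
    qAvg L j y lam = 0 ↔ ∑ x ∈ ablock (L ^ j) y, lam x = 0 := by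
  unfold qAvg
  have hL0 : ((((L : ℂ) ^ j) ^ D)⁻¹) ≠ 0 := by
    apply inv_ne_zero
    have : (L : ℂ) ≠ 0 := by exact_mod_cast (show L ≠ 0 by omega)
    exact pow_ne_zero _ (pow_ne_zero _ this)
  rw [mul_eq_zero, or_iff_right hL0]

namespace Domains

variable (G : Domains D)

/-- `Ω_j^{(j)}` as a label set for EVERY `j`, with the two conventions that make (2.3) one formula: `Ω₀^{(0)} := T_η`
(level-`0` labels are the sites themselves) and `Ω_j := ∅` for `j > k`. [cite: Balaban1984PropagatorsII, (2.1)–(2.3) p.224] -/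
def dom (j : ℕ) : Finset (Fin D → ℤ) := if j = 0 then G.T else if j ≤ G.k then G.Ω j else ∅

/-- **(2.3)** p. 224, verbatim: *"Λ_j = Ω_j^{(j)}∖Ω_{j+1}^{(j)}, j = 1, …, k − 1, Λ_k = Ω_k^{(k)}, Λ₀ = Ω₁^c (2.3) for the
sets of sites"* — as label sets, all three clauses at once: `Λ_j` = the level-`j` labels `y ∈ Ω_j^{(j)}` whose point
`L^j·y` does not lie in `Ω_{j+1}`, i.e. with `⌊y/L⌋ ∉ Ω_{j+1}^{(j+1)}` (for `j = k` there is no `Ω_{k+1}`; for `j = 0`,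
`Ω₀^{(0)} = T_η` and `Λ₀` = the sites of `T_η` outside `Ω₁`). [cite: Balaban1984PropagatorsII, (2.3) p.224] -/
def lam (j : ℕ) : Finset (Fin D → ℤ) := (G.dom j).filter fun y => coarse G.L y ∉ G.dom (j + 1)

/-- `Ω_j = B^j(Ω_j^{(j)})` as a set of SITES (first clause of (2.2)); `Ω₀ = T_η`, `Ω_j = ∅` for `j > k`.
[cite: Balaban1984PropagatorsII, (2.2) p.224] -/
def oms (j : ℕ) : Finset (Fin D → ℤ) := (G.dom j).biUnion (ablock (G.L ^ j))

/-- `B^j(Λ_j) = ⋃_{y∈Λ_j} B^j(y)` as a set of sites (*"where B⁰(Λ₀) = Λ₀"*: a level-`0` block is a single site).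
[cite: Balaban1984PropagatorsII, (2.4) p.224] -/
def blk (j : ℕ) : Finset (Fin D → ℤ) := (G.lam j).biUnion (ablock (G.L ^ j))

/-- **`N(Q′)` (2.10)** = the gauge functions (2.7) p. 224, verbatim: *"λ = 0 on Λ₀, Q′_jλ = 0 on Λ_j, j = 1, …, k.
(2.7)"*, *"N(Q′) = {λ : λ satisfies (2.7)} (2.10)"* — with the p. 225 convention `Q′₀λ = λ` on `Λ₀` this is
`Q′_jλ = 0 on Λ_j` for every `0 ≤ j ≤ k` (unfolded to the printed two clauses in `nq_iff`).
[cite: Balaban1984PropagatorsII, (2.7) p.224, (2.10) p.225] -/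
def NQ (lam' : (Fin D → ℤ) → ℂ) : Prop := ∀ j ≤ G.k, ∀ y ∈ G.lam j, qAvg G.L j y lam' = 0

/-! ### bookkeeping -/

/-- `L^j ≥ 1`: a level-`j` block `B^j(y)` has `L^j ≥ 1` sites per direction. [cite: Balaban1984PropagatorsII, (2.2) p.224] -/
theorem one_le_pow (j : ℕ) : 1 ≤ G.L ^ j := Nat.one_le_pow _ _ G.one_le_L

/-- `Ω₀^{(0)} = T_η`. [folklore] -/
private theorem dom_zero : G.dom 0 = G.T := by simp [dom]

/-- `Ω_j^{(j)} = Ω j` for `1 ≤ j ≤ k`. [folklore] -/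
private theorem dom_of_mem {j : ℕ} (h1 : 1 ≤ j) (h2 : j ≤ G.k) : G.dom j = G.Ω j := by
  simp [dom, show j ≠ 0 by omega, h2]

/-- `Ω_j = ∅` for `j > k`. [folklore] -/
private theorem dom_of_lt {j : ℕ} (h : G.k < j) : G.dom j = ∅ := by
  simp [dom, show j ≠ 0 by omega, show ¬ j ≤ G.k by omega]

/-- `⌊x/1⌋ = x`. [folklore] -/
private theorem coarse_one (x : Fin D → ℤ) : coarse 1 x = x := by
  funext ν; simp [coarse]

/-- membership in `Λ_j` (2.3): `y ∈ Ω_j^{(j)}` and `⌊y/L⌋ ∉ Ω_{j+1}^{(j+1)}`. [cite: Balaban1984PropagatorsII, (2.3) p.224] -/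
theorem mem_lam {j : ℕ} {y : Fin D → ℤ} : y ∈ G.lam j ↔ y ∈ G.dom j ∧ coarse G.L y ∉ G.dom (j + 1) :=
  Finset.mem_filter

/-- `N(Q′)` unfolded to the two printed clauses of (2.7): `λ = 0 on Λ₀` and `Σ_{x∈B^j(y)}λ(x) = 0` (`⇔ Q′_jλ(y) = 0`)
for `y ∈ Λ_j`, `1 ≤ j ≤ k`. [cite: Balaban1984PropagatorsII, (2.7) p.224, (2.10) p.225] -/
theorem nq_iff (lam' : (Fin D → ℤ) → ℂ) :
    G.NQ lam' ↔ (∀ x ∈ G.lam 0, lam' x = 0) ∧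
      ∀ j, 1 ≤ j → j ≤ G.k → ∀ y ∈ G.lam j, ∑ x ∈ ablock (G.L ^ j) y, lam' x = 0 := by
  have h0 : ∀ x : Fin D → ℤ, qAvg G.L 0 x lam' = lam' x := fun x => by
    unfold qAvg
    have : ablock (G.L ^ 0) x = {x} := by
      ext z; rw [pow_zero, mem_ablock le_rfl, coarse_one, Finset.mem_singleton]
    rw [this, Finset.sum_singleton]; simp
  constructor
  · intro h
    refine ⟨fun x hx => by rw [← h0 x]; exact h 0 (Nat.zero_le _) x hx, fun j _ hjk y hy => ?_⟩
    exact (qAvg_eq_zero_iff G.one_le_L j y lam').mp (h j hjk y hy)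
  · rintro ⟨hz, hpos⟩ j hj y hy
    rcases Nat.eq_zero_or_pos j with rfl | hj1
    · rw [h0]; exact hz y hy
    · exact (qAvg_eq_zero_iff G.one_le_L j y lam').mpr (hpos j hj1 hj y hy)

/-- `x ∈ Ω_j` (sites) iff the label `⌊x/L^j⌋` of its level-`j` block lies in `Ω_j^{(j)}`. [cite: Balaban1984PropagatorsII, (2.2) p.224] -/
theorem mem_oms {j : ℕ} {x : Fin D → ℤ} : x ∈ G.oms j ↔ coarse (G.L ^ j) x ∈ G.dom j := by
  unfold oms
  rw [Finset.mem_biUnion]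
  constructor
  · rintro ⟨y, hy, hx⟩
    rwa [(mem_ablock (G.one_le_pow j)).mp hx]
  · intro h
    exact ⟨_, h, (mem_ablock (G.one_le_pow j)).mpr rfl⟩

/-- `x ∈ B^j(Λ_j)` iff the label of its level-`j` block lies in `Λ_j`. [cite: Balaban1984PropagatorsII, (2.4) p.224] -/
theorem mem_blk {j : ℕ} {x : Fin D → ℤ} : x ∈ G.blk j ↔ coarse (G.L ^ j) x ∈ G.lam j := by
  unfold blk
  rw [Finset.mem_biUnion]
  constructor
  · rintro ⟨y, hy, hx⟩
    rwa [(mem_ablock (G.one_le_pow j)).mp hx]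
  · intro h
    exact ⟨_, h, (mem_ablock (G.one_le_pow j)).mpr rfl⟩

/-- nested block labels: `⌊x/L^{j+1}⌋ = ⌊⌊x/L^j⌋/L⌋`. [folklore] -/
private theorem coarse_succ (j : ℕ) (x : Fin D → ℤ) :
    coarse (G.L ^ (j + 1)) x = coarse G.L (coarse (G.L ^ j) x) := by
  rw [coarse_coarse, ← pow_succ']

/-- **`B^j(Λ_j) = Ω_j ∖ Ω_{j+1}`** as sets of sites, for every `j` ((2.3) read on sites; `Ω₀ = T_η`, `Ω_{k+1} = ∅`).
[cite: Balaban1984PropagatorsII, (2.3)–(2.4) p.224] -/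
theorem blk_eq_sdiff (j : ℕ) : G.blk j = G.oms j \ G.oms (j + 1) := by
  ext x
  rw [mem_blk, mem_lam, Finset.mem_sdiff, mem_oms, mem_oms, coarse_succ]

/-- (2.1) on sites, one step: `Ω_{j+1} ⊆ Ω_j` for every `j` (`j = 0`: `Ω₁ ⊆ T_η`; `j ≥ k`: `Ω_{j+1} = ∅`). [cite: Balaban1984PropagatorsII, (2.1) p.224] -/
theorem oms_succ_subset (j : ℕ) : G.oms (j + 1) ⊆ G.oms j := by
  intro x hx
  rw [mem_oms] at hx ⊢
  rcases Nat.eq_zero_or_pos j with rfl | hj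
  · rw [dom_zero, pow_zero, coarse_one]
    have h1 : 1 ≤ G.k := by
      by_contra h
      rw [G.dom_of_lt (by omega)] at hx
      simp at hx
    rw [zero_add, G.dom_of_mem le_rfl h1] at hx
    exact G.sub_T 1 le_rfl h1 _ hx ((mem_ablock (G.one_le_pow 1)).mpr rfl)
  · by_cases hk : j + 1 ≤ G.k
    · rw [G.dom_of_mem (by omega) hk, coarse_succ] at hx
      rw [G.dom_of_mem hj (by omega)]
      exact G.nested j hj (by omega) _ hx
    · rw [G.dom_of_lt (by omega)] at hx
      simp at hx

/-- **(2.1)** *"Ω₁ ⊃ Ω₂ ⊃ … ⊃ Ω_k"* on sites, with `T_η = Ω₀ ⊇ Ω₁` and `Ω_j = ∅` beyond `k`: `i ≤ j ⇒ Ω_j ⊆ Ω_i`.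
[cite: Balaban1984PropagatorsII, (2.1) p.224] -/
theorem oms_antitone {i j : ℕ} (h : i ≤ j) : G.oms j ⊆ G.oms i := by
  induction h with
  | refl => exact le_rfl
  | step _ ih => exact (G.oms_succ_subset _).trans ih

/-- `Ω₀ = T_η`. [folklore] -/
private theorem oms_zero : G.oms 0 = G.T := by
  ext x
  rw [mem_oms, dom_zero, pow_zero, coarse_one]

/-- `Ω_j = ∅` for `j > k`. [folklore] -/
private theorem oms_of_lt {j : ℕ} (h : G.k < j) : G.oms j = ∅ := by
  ext x
  rw [mem_oms, G.dom_of_lt h]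
  simp

/-- every `B^j(Λ_j)` lies in `T_η`. [cite: Balaban1984PropagatorsII, (2.4) p.224] -/
theorem blk_subset_T (j : ℕ) : G.blk j ⊆ G.T := by
  intro x hx
  rw [blk_eq_sdiff, Finset.mem_sdiff] at hx
  rw [← oms_zero]
  exact G.oms_antitone (Nat.zero_le j) hx.1

/-- **(2.4), disjointness**: the sets `B^j(Λ_j)`, `j ≥ 0`, are pairwise disjoint (the union in *"T = ⋃_{j=0}^k B^j(Λ_j)"*
is a partition). [cite: Balaban1984PropagatorsII, (2.4) p.224] -/
theorem blk_disjoint {i j : ℕ} (h : i ≠ j) : Disjoint (G.blk i) (G.blk j) := by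
  wlog hij : i < j generalizing i j
  · exact (this h.symm (by omega)).symm
  rw [blk_eq_sdiff, blk_eq_sdiff, Finset.disjoint_left]
  intro x hx hx'
  rw [Finset.mem_sdiff] at hx hx'
  exact hx.2 (G.oms_antitone (by omega : i + 1 ≤ j) hx'.1)

/-- **(2.4), covering** p. 224, verbatim: *"T = ⋃_{j=0}^k B^j(Λ_j), where B⁰(Λ₀) = Λ₀. (2.4)"* — PROVED from (2.1)
and (2.3) (a site of `T_η = Ω₀` leaves the chain `Ω₀ ⊇ Ω₁ ⊇ …  ⊇ Ω_{k+1} = ∅` at a least level `i + 1`, and then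
lies in `Ω_i ∖ Ω_{i+1} = B^i(Λ_i)`). [cite: Balaban1984PropagatorsII, (2.4) p.224] -/
theorem biUnion_blk : (Finset.range (G.k + 1)).biUnion G.blk = G.T := by
  ext x
  rw [Finset.mem_biUnion]
  constructor
  · rintro ⟨j, -, hx⟩
    exact G.blk_subset_T j hx
  · intro hx
    have hex : ∃ j, x ∉ G.oms j := ⟨G.k + 1, by rw [G.oms_of_lt (by omega)]; simp⟩
    classical
    have hj₀ : x ∉ G.oms (Nat.find hex) := Nat.find_spec hex
    have hpos : 0 < Nat.find hex := by
      by_contra h0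
      have : Nat.find hex = 0 := by omega
      rw [this, oms_zero] at hj₀
      exact hj₀ hx
    obtain ⟨i, hi⟩ : ∃ i, Nat.find hex = i + 1 := ⟨Nat.find hex - 1, by omega⟩
    have hxi : x ∈ G.oms i := by
      by_contra hne
      exact Nat.find_min hex (show i < Nat.find hex by omega) hne
    have hik : i ≤ G.k := by
      by_contra hne
      rw [G.oms_of_lt (by omega)] at hxi
      simp at hxi
    refine ⟨i, Finset.mem_range.mpr (by omega), ?_⟩
    rw [blk_eq_sdiff, Finset.mem_sdiff, ← hi]
    exact ⟨hxi, hj₀⟩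

/-! ## §2 The block family `{B^j(y) : y ∈ Λ_j, 0 ≤ j ≤ k}` of (2.4) as an indexed family (the input of (2.11)) -/

/-- the index set of all blocks `B^j(y)`, `y ∈ Λ_j`, `0 ≤ j ≤ k`, as pairs `⟨j, y⟩`. [cite: Balaban1984PropagatorsII, (2.4) p.224] -/
def cells : Finset (Σ _ : ℕ, Fin D → ℤ) := (Finset.range (G.k + 1)).sigma G.lam

/-- the blocks `B^j(y)`, `⟨j, y⟩ ∈ cells`, are pairwise disjoint (same level: distinct aligned blocks; different
levels: (2.4)). [cite: Balaban1984PropagatorsII, (2.4) p.224] -/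
theorem cells_pairwiseDisjoint :
    (G.cells : Set (Σ _ : ℕ, Fin D → ℤ)).PairwiseDisjoint fun i => ablock (G.L ^ i.1) i.2 := by
  rintro ⟨i, y⟩ hi ⟨j, y'⟩ hj hne
  have hy : y ∈ G.lam i := (Finset.mem_sigma.mp hi).2
  have hy' : y' ∈ G.lam j := (Finset.mem_sigma.mp hj).2
  by_cases hij : i = j
  · subst hij
    have hyy : y ≠ y' := fun h => hne (by rw [h])
    exact ablock_disjoint (G.one_le_pow i) hyy
  · refine Finset.disjoint_of_subset_left ?_ (Finset.disjoint_of_subset_right ?_ (G.blk_disjoint hij))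
    · exact Finset.subset_biUnion_of_mem (ablock (G.L ^ i)) hy
    · exact Finset.subset_biUnion_of_mem (ablock (G.L ^ j)) hy'

/-- every block `B^j(y)`, `y ∈ Λ_j`, lies in `T_η`. [cite: Balaban1984PropagatorsII, (2.4) p.224] -/
theorem cells_subset_T : ∀ i ∈ G.cells, ablock (G.L ^ i.1) i.2 ⊆ G.T := by
  rintro ⟨j, y⟩ hi
  have hy : y ∈ G.lam j := (Finset.mem_sigma.mp hi).2
  exact (Finset.subset_biUnion_of_mem (ablock (G.L ^ j)) hy).trans (G.blk_subset_T j)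

/-- `Σ_{x∈B^j(Λ_j)} = Σ_{y∈Λ_j} Σ_{x∈B^j(y)}`. [cite: Balaban1984PropagatorsII, (2.4) p.224] -/
theorem sum_blk (j : ℕ) (f : (Fin D → ℤ) → ℝ) :
    ∑ x ∈ G.blk j, f x = ∑ y ∈ G.lam j, ∑ x ∈ ablock (G.L ^ j) y, f x :=
  Finset.sum_biUnion fun _ _ _ _ h => ablock_disjoint (G.one_le_pow j) h

end Domains

end

end Literature.MathematicalPhysics.QuantumFieldTheory.Balaban1983to89.B6Eq24Partition
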